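import Summits.QuantumAdvantage.QuantumAdvantage.Theorems.SosSandwichPseudoBoundedAAChebyshevCalibration
import Mathlib.Analysis.Calculus.Deriv.MeanValue

/-!
# Route `SosSandwich`, crux `PseudoBoundedAA` (stmt-QuantumAdvantage-15237) — the Chebyshev family sits AT the
`(Var², T²)` corner: matching influence LOWER bound

Helper (`--supports stmt-QuantumAdvantage-15237`), conjecture-free, no named facts; completes the Chebyshev
package (`…ChebyshevFamily/Influence/Variance/Binomial/Calibration.lean`, `…ExponentCorner.lean`).

The calibration showed `b ≥ 2` for every law `maxInf ≥ C·Var^a/T^b` on `K` using the UPPER bound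
`Infᵢ[p_k] ≤ 29/k²` of the amplitude-amplification family `p_k = T_k(ȳ)²` on `N = k²` variables. This file
proves the matching LOWER bound on the same instance (`k = 12r`):

* §1 `abs_deriv_chebyshevT_sq_ge`: `|(T_k²)'(z)| ≥ k·|sin(2k·arccos z)|` for `|z| < 1`
  (`(T_k²)' = 2k·T_k·U_{k−1}`, `T_k(cos θ) = cos kθ`, `U_{k−1}(cos θ) sin θ = sin kθ`, `sin θ ≤ 1`);
  `abs_chebyshevT_sq_sub_ge`: mean-value LOWER bound `|T_k(z)² − T_k(z')²| ≥ m·|z − z'|` when `|(T_k²)'| ≥ m`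
  between `z` and `z'`.
* §2 `abs_sin_two_mul_arccos_ge`: the oscillation window `1/(36r) ≤ |ξ| ≤ 5/(72r)` ⟹ `|sin(2k·arccos ξ)| ≥ 1/2`
  (`k = 12r`; `v ≤ arcsin v ≤ (π/2)·v` puts `24r·arcsin|ξ|` in `[2/3, 5π/6] ⊂ [π/6, 5π/6]`).
* §3 on the calibrating instance: weights in `[72r² + 2r + 1, 72r² + 5r − 1]` ⟹ `(p_k(x) − p_k(xⁱ))² ≥ 1/k²` for
  EVERY `i` (`sq_sub_flipBit_chebyshevT_sq_ge`); that window has probability `≥ 47/648` (binomial bounds of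
  `…ChebyshevBinomial.lean`), hence **`Infᵢ[p_k] ≥ (47/648)/k²` for every variable** (`influence_chebyshevT_sq_ge`),
  to be compared with `Infᵢ[p_k] ≤ 29/k²` (`…ChebyshevInfluence.lean`; numerics `2.00/k²`); and
  **`chebyshev_family_twoTwo_law`**: `Infᵢ[p_k] ≥ (94/81)·Var[p_k]²/k²` (using `Var ≤ 1/4`).

MEANING. The calibrator that kills every linear-`T`-loss law does NOT cross the `(2, 2)` corner: on it the
candidate law `maxInf ≥ C·Var²/T²` holds with an absolute constant. So, within everything the tree knows
(mean-square and averaged-address families on the `Var` side, Chebyshev on the `T` side), `maxInf ≥ C·Var²/T²`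
— PB-AA with `c = 2` — remains consistent, and it is the strongest law that does. Honest label: calibration;
no law is proved on `K`.

Sources: amplitude amplification / polynomial method [cite: BealsEtAl2001, §4]; the class `K_T`
[cite: KaniewskiLeeDewolf2015, Def. 7]; Chebyshev polynomials, Jordan's inequality, mean value theorem [folklore].
-/

set_option linter.dupNamespace false

noncomputable section

namespace Summit.QuantumAdvantage.QuantumAdvantage.Theorems.SosSandwich

open Finset
open Literature.Computability.QuantumComplexity

variable {N : ℕ}

/-! ### §1 A lower bound for the derivative of `T_k²` and a mean-value lower bound -/

/-- `|d/dz T_k(z)²| ≥ k·|sin(2k·arccos z)|` for `|z| < 1` (`(T_k²)' = 2k·T_k·U_{k−1}`,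
`T_k(cos θ) = cos kθ`, `U_{k−1}(cos θ)·sin θ = sin kθ`, `0 < sin θ ≤ 1`). [folklore] -/
theorem abs_deriv_chebyshevT_sq_ge (k : ℕ) {z : ℝ} (hz1 : -1 < z) (hz2 : z < 1) :
    (k : ℝ) * |Real.sin (2 * k * Real.arccos z)| ≤
      |deriv (fun w => (Polynomial.Chebyshev.T ℝ (k : ℤ) ^ 2).eval w) z| := by
  rw [Polynomial.deriv, Polynomial.derivative_sq, Polynomial.Chebyshev.T_derivative_eq_U]
  simp only [Polynomial.eval_mul, Polynomial.eval_C, Int.cast_natCast, Polynomial.eval_natCast]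
  set θ := Real.arccos z with hθ
  have hzθ : z = Real.cos θ := (Real.cos_arccos hz1.le hz2.le).symm
  have hsin_pos : 0 < Real.sin θ := by
    rw [hθ, Real.sin_arccos]
    apply Real.sqrt_pos.mpr
    nlinarith
  have hsin_le : Real.sin θ ≤ 1 := Real.sin_le_one θ
  have hT : (Polynomial.Chebyshev.T ℝ (k : ℤ)).eval z = Real.cos (k * θ) := by
    rw [hzθ, Polynomial.Chebyshev.T_real_cos]; push_cast; ring_nf
  have hU : (Polynomial.Chebyshev.U ℝ ((k : ℤ) - 1)).eval z * Real.sin θ = Real.sin (k * θ) := by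
    rw [hzθ, Polynomial.Chebyshev.U_real_cos]; push_cast; ring_nf
  have h2 : Real.sin (2 * k * Real.arccos z) = 2 * Real.sin (k * θ) * Real.cos (k * θ) := by
    rw [← hθ, show (2 : ℝ) * k * θ = 2 * (k * θ) by ring, Real.sin_two_mul]
  -- `|2 T (k U)| · sin θ = k |sin 2kθ|`, and `sin θ ≤ 1`
  have key : |2 * (Polynomial.Chebyshev.T ℝ (k : ℤ)).eval z *
      ((k : ℝ) * (Polynomial.Chebyshev.U ℝ ((k : ℤ) - 1)).eval z)| * Real.sin θ =
      (k : ℝ) * |Real.sin (2 * k * Real.arccos z)| := by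
    rw [h2, ← abs_of_pos hsin_pos, ← abs_mul]
    rw [show 2 * (Polynomial.Chebyshev.T ℝ (k : ℤ)).eval z *
        ((k : ℝ) * (Polynomial.Chebyshev.U ℝ ((k : ℤ) - 1)).eval z) * Real.sin θ =
        (k : ℝ) * (2 * ((Polynomial.Chebyshev.U ℝ ((k : ℤ) - 1)).eval z * Real.sin θ) *
          (Polynomial.Chebyshev.T ℝ (k : ℤ)).eval z) by ring, hU, hT, abs_mul, Nat.abs_cast]
  have hA : 0 ≤ |2 * (Polynomial.Chebyshev.T ℝ (k : ℤ)).eval z *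
      ((k : ℝ) * (Polynomial.Chebyshev.U ℝ ((k : ℤ) - 1)).eval z)| := abs_nonneg _
  calc (k : ℝ) * |Real.sin (2 * k * Real.arccos z)|
      = |2 * (Polynomial.Chebyshev.T ℝ (k : ℤ)).eval z *
          ((k : ℝ) * (Polynomial.Chebyshev.U ℝ ((k : ℤ) - 1)).eval z)| * Real.sin θ := key.symm
    _ ≤ |2 * (Polynomial.Chebyshev.T ℝ (k : ℤ)).eval z *
          ((k : ℝ) * (Polynomial.Chebyshev.U ℝ ((k : ℤ) - 1)).eval z)| * 1 :=
        mul_le_mul_of_nonneg_left hsin_le hA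
    _ = _ := mul_one _

/-- Mean-value LOWER bound: if `|(T_k²)'| ≥ m` on the segment between `z` and `z'`, then
`|T_k(z)² − T_k(z')²| ≥ m·|z − z'|`. [folklore] -/
theorem abs_chebyshevT_sq_sub_ge (k : ℕ) {z z' m : ℝ}
    (hm : ∀ ξ, min z z' ≤ ξ → ξ ≤ max z z' →
      m ≤ |deriv (fun w => (Polynomial.Chebyshev.T ℝ (k : ℤ) ^ 2).eval w) ξ|) :
    m * |z - z'| ≤ |(Polynomial.Chebyshev.T ℝ (k : ℤ)).eval z ^ 2 -
      (Polynomial.Chebyshev.T ℝ (k : ℤ)).eval z' ^ 2| := by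
  set f : ℝ → ℝ := fun w => (Polynomial.Chebyshev.T ℝ (k : ℤ) ^ 2).eval w with hf
  have hfe : ∀ w, f w = (Polynomial.Chebyshev.T ℝ (k : ℤ)).eval w ^ 2 := fun w => by
    simp [hf, Polynomial.eval_pow]
  rcases lt_trichotomy z z' with hlt | heq | hgt
  · obtain ⟨c, hc, hderiv⟩ := exists_deriv_eq_slope f hlt
      (Polynomial.continuous _).continuousOn (Polynomial.differentiable _).differentiableOn
    have hcm := hm c (by rw [min_eq_left hlt.le]; exact hc.1.le) (by rw [max_eq_right hlt.le]; exact hc.2.le)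
    rw [hderiv, abs_div] at hcm
    have hpos : 0 < |z' - z| := abs_pos.mpr (sub_ne_zero.mpr (ne_of_gt hlt))
    rw [le_div_iff₀ hpos] at hcm
    rw [abs_sub_comm z z', ← hfe, ← hfe, abs_sub_comm (f z) (f z')]
    exact hcm
  · subst heq; simp
  · obtain ⟨c, hc, hderiv⟩ := exists_deriv_eq_slope f hgt
      (Polynomial.continuous _).continuousOn (Polynomial.differentiable _).differentiableOn
    have hcm := hm c (by rw [min_eq_right hgt.le]; exact hc.1.le) (by rw [max_eq_left hgt.le]; exact hc.2.le)
    rw [hderiv, abs_div] at hcm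
    have hpos : 0 < |z - z'| := abs_pos.mpr (sub_ne_zero.mpr (ne_of_gt hgt))
    rw [le_div_iff₀ hpos] at hcm
    rw [← hfe, ← hfe]
    exact hcm

/-! ### §2 The oscillation window: `|sin(2k·arccos ξ)| ≥ 1/2` for `1/(36r) ≤ |ξ| ≤ 5/(72r)`, `k = 12r` -/

/-- For `k = 12r` and `1/(36r) ≤ |ξ| ≤ 5/(72r)`: `|sin(2k·arccos ξ)| ≥ 1/2`
(`2k·arccos ξ = 12rπ·… − 24r·arcsin ξ`, `v ≤ arcsin v ≤ (π/2)v`, so `24r·arcsin|ξ| ∈ [2/3, 5π/6] ⊂ [π/6, 5π/6]`).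
[folklore] -/
theorem abs_sin_two_mul_arccos_ge (r : ℕ) (hr : 1 ≤ r) {ξ : ℝ}
    (h1 : 1 / (36 * (r : ℝ)) ≤ |ξ|) (h2 : |ξ| ≤ 5 / (72 * (r : ℝ))) :
    1 / 2 ≤ |Real.sin (2 * ((4 * (3 * r) : ℕ) : ℝ) * Real.arccos ξ)| := by
  have hr0 : (0 : ℝ) < r := by exact_mod_cast (show 0 < r by omega)
  have hr1 : (1 : ℝ) ≤ r := by exact_mod_cast hr
  have hpi := Real.pi_pos
  have hpi3 := Real.pi_gt_three
  have hpi4 := Real.pi_lt_d2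
  have hξ1 : |ξ| ≤ 1 := h2.trans (by rw [div_le_one (by positivity)]; nlinarith)
  -- reduce to `v = |ξ|`
  rw [Real.arccos_eq_pi_div_two_sub_arcsin]
  have hred : Real.sin (2 * ((4 * (3 * r) : ℕ) : ℝ) * (Real.pi / 2 - Real.arcsin ξ)) =
      -Real.sin (24 * r * Real.arcsin ξ) := by
    have : 2 * ((4 * (3 * r) : ℕ) : ℝ) * (Real.pi / 2 - Real.arcsin ξ) =
        ((6 * r : ℕ) : ℝ) * (2 * Real.pi) - 24 * r * Real.arcsin ξ := by push_cast; ring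
    rw [this, Real.sin_nat_mul_two_pi_sub]
  rw [hred, abs_neg]
  have hodd : |Real.sin (24 * r * Real.arcsin ξ)| = |Real.sin (24 * r * Real.arcsin |ξ|)| := by
    rcases le_total 0 ξ with h | h
    · rw [abs_of_nonneg h]
    · rw [abs_of_nonpos h, Real.arcsin_neg, mul_neg, Real.sin_neg, abs_neg]
  rw [hodd]
  set v := |ξ| with hv
  have hv0 : 0 ≤ v := abs_nonneg ξ
  -- `v ≤ arcsin v ≤ (π/2) v`
  have has0 : 0 ≤ Real.arcsin v := Real.arcsin_nonneg.mpr hv0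
  have has2 : Real.arcsin v ≤ Real.pi / 2 := Real.arcsin_le_pi_div_two v
  have hlow : v ≤ Real.arcsin v := by
    have := Real.sin_le has0
    rwa [Real.sin_arcsin (by linarith [hv0]) hξ1] at this
  have hup : Real.arcsin v ≤ Real.pi / 2 * v := by
    have := Real.mul_le_sin has0 has2
    rw [Real.sin_arcsin (by linarith [hv0]) hξ1] at this
    have h' : Real.arcsin v * 2 ≤ Real.pi * v := by
      have := mul_le_mul_of_nonneg_left this (le_of_lt (half_pos hpi))
      have e : Real.pi / 2 * (2 / Real.pi * Real.arcsin v) = Real.arcsin v := by field_simp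
      nlinarith [e, this]
    linarith
  set u := 24 * (r : ℝ) * Real.arcsin v with hu
  have hu1 : Real.pi / 6 ≤ u := by
    have : (24 : ℝ) * r * (1 / (36 * r)) = 2 / 3 := by field_simp; ring
    have h3 : 24 * (r : ℝ) * (1 / (36 * r)) ≤ 24 * r * Real.arcsin v :=
      mul_le_mul_of_nonneg_left (h1.trans hlow) (by positivity)
    rw [this] at h3
    linarith
  have hu2 : u ≤ 5 * Real.pi / 6 := by
    have h3 : 24 * (r : ℝ) * Real.arcsin v ≤ 24 * r * (Real.pi / 2 * (5 / (72 * r))) :=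
      mul_le_mul_of_nonneg_left (hup.trans (mul_le_mul_of_nonneg_left h2 (by positivity))) (by positivity)
    have : 24 * (r : ℝ) * (Real.pi / 2 * (5 / (72 * r))) = 5 * Real.pi / 6 := by field_simp; ring
    rw [this] at h3
    exact h3
  -- `sin u ≥ 1/2` on `[π/6, 5π/6]`
  have hsin : 1 / 2 ≤ Real.sin u := by
    rcases le_total u (Real.pi / 2) with hle | hge
    · rw [← Real.sin_pi_div_six]
      exact Real.sin_le_sin_of_le_of_le_pi_div_two (by linarith) hle hu1
    · rw [← Real.sin_pi_div_six, ← Real.sin_pi_sub u]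
      exact Real.sin_le_sin_of_le_of_le_pi_div_two (by linarith) (by linarith) (by linarith)
  exact hsin.trans (le_abs_self _)

/-! ### §3 The calibrating instance `k = 12r`, `N = 144r²`: a pointwise sensitivity LOWER bound on the
oscillation window `wt ∈ [72r² + 2r + 1, 72r² + 5r − 1]` -/

/-- On the oscillation window, every bit flip moves `p_k` by at least `k/N = 1/k`:
`(p_k(x) − p_k(xⁱ))² ≥ 1/(144r²)`. [folklore] -/
theorem sq_sub_flipBit_chebyshevT_sq_ge (r : ℕ) (hr : 1 ≤ r) (i : Fin (144 * r ^ 2))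
    (x : Fin (144 * r ^ 2) → Bool)
    (hx : (Finset.univ.filter (fun j => x j = true)).card ∈
      Finset.Icc (72 * r ^ 2 + 2 * r + 1) (72 * r ^ 2 + 5 * r - 1)) :
    1 / (144 * (r : ℝ) ^ 2) ≤
      (evalBool ((Polynomial.aeval (∑ i : Fin (144 * r ^ 2), (MvPolynomial.C (1 / ((144 * r ^ 2 : ℕ) : ℝ)) -
          MvPolynomial.C (2 / ((144 * r ^ 2 : ℕ) : ℝ)) * MvPolynomial.X i))
          (Polynomial.Chebyshev.T ℝ ((4 * (3 * r) : ℕ) : ℤ))) ^ 2) x -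
        evalBool ((Polynomial.aeval (∑ i : Fin (144 * r ^ 2), (MvPolynomial.C (1 / ((144 * r ^ 2 : ℕ) : ℝ)) -
          MvPolynomial.C (2 / ((144 * r ^ 2 : ℕ) : ℝ)) * MvPolynomial.X i))
          (Polynomial.Chebyshev.T ℝ ((4 * (3 * r) : ℕ) : ℤ))) ^ 2) (flipBit i x)) ^ 2 := by
  have hr0 : (0 : ℝ) < r := by exact_mod_cast (show 0 < r by omega)
  have hr1 : (1 : ℝ) ≤ r := by exact_mod_cast hr
  rw [evalBool_chebyshevT_sq, evalBool_chebyshevT_sq, signMeanVal_flipBit, signMeanVal_eq_weight]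
  rw [Finset.mem_Icc] at hx
  set w := (Finset.univ.filter (fun j => x j = true)).card with hw
  have hw1 : (72 * r ^ 2 + 2 * r + 1 : ℝ) ≤ (w : ℝ) := by exact_mod_cast hx.1
  have hw2 : (w : ℝ) ≤ 72 * r ^ 2 + 5 * r - 1 := by
    have : w + 1 ≤ 72 * r ^ 2 + 5 * r := by omega
    have : ((w + 1 : ℕ) : ℝ) ≤ ((72 * r ^ 2 + 5 * r : ℕ) : ℝ) := by exact_mod_cast this
    push_cast at this; linarith
  set e : ℝ := (1 - 2 * (if x i then (1 : ℝ) else 0)) with he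
  have he1 : |e| = 1 := by rw [he]; cases x i <;> norm_num
  set z : ℝ := (((144 * r ^ 2 : ℕ) : ℝ) - 2 * (w : ℝ)) / ((144 * r ^ 2 : ℕ) : ℝ) with hz
  set z' : ℝ := z - 2 / ((144 * r ^ 2 : ℕ) : ℝ) * e with hz'
  -- `z ∈ [-(5r-1)/(72r²), -(2r+1)/(72r²)]`
  have hzup : z ≤ -(2 * r + 1) / (72 * r ^ 2) := by
    rw [hz]; push_cast
    rw [div_le_div_iff₀ (by positivity) (by positivity)]; nlinarith
  have hzlo : -(5 * r - 1) / (72 * (r : ℝ) ^ 2) ≤ z := by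
    rw [hz]; push_cast
    rw [div_le_div_iff₀ (by positivity) (by positivity)]; nlinarith
  have hstep : |z' - z| = 1 / (72 * (r : ℝ) ^ 2) := by
    rw [hz', show z - 2 / ((144 * r ^ 2 : ℕ) : ℝ) * e - z = -(2 / ((144 * r ^ 2 : ℕ) : ℝ) * e) by ring,
      abs_neg, abs_mul (2 / ((144 * r ^ 2 : ℕ) : ℝ)) e, he1, mul_one, abs_of_pos (by positivity)]
    push_cast; field_simp; ring
  have hestep : |2 / ((144 * r ^ 2 : ℕ) : ℝ) * e| = 1 / (72 * (r : ℝ) ^ 2) := by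
    rw [abs_mul (2 / ((144 * r ^ 2 : ℕ) : ℝ)) e, he1, mul_one, abs_of_pos (by positivity)]
    push_cast; field_simp; ring
  -- every `ξ` between `z` and `z'` has `1/(36r) ≤ |ξ| ≤ 5/(72r)` and `|ξ| < 1`
  have hwin : ∀ ξ, min z z' ≤ ξ → ξ ≤ max z z' →
      ((4 * (3 * r) : ℕ) : ℝ) / 2 ≤
        |deriv (fun w => (Polynomial.Chebyshev.T ℝ ((4 * (3 * r) : ℕ) : ℤ) ^ 2).eval w) ξ| := by
    intro ξ hξ1 hξ2
    have hξlo : -(5 * (r : ℝ)) / (72 * r ^ 2) ≤ ξ := by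
      have hmin : z - 1 / (72 * (r : ℝ) ^ 2) ≤ min z z' := by
        apply le_min (by linarith [show (0:ℝ) < 1 / (72 * r ^ 2) by positivity])
        have := le_abs_self (2 / ((144 * r ^ 2 : ℕ) : ℝ) * e)
        rw [hestep] at this; rw [hz']; linarith
      have h5 : -(5 * (r : ℝ)) / (72 * r ^ 2) = -(5 * r - 1) / (72 * (r : ℝ) ^ 2) - 1 / (72 * r ^ 2) := by
        field_simp; ring
      linarith [hmin, hξ1, hzlo, h5]
    have hξup : ξ ≤ -(2 * (r : ℝ)) / (72 * r ^ 2) := by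
      have hmax : max z z' ≤ z + 1 / (72 * (r : ℝ) ^ 2) := by
        apply max_le (by linarith [show (0:ℝ) < 1 / (72 * r ^ 2) by positivity])
        have := neg_abs_le (2 / ((144 * r ^ 2 : ℕ) : ℝ) * e)
        rw [hestep] at this; rw [hz']; linarith
      have h2 : -(2 * (r : ℝ)) / (72 * r ^ 2) = -(2 * r + 1) / (72 * (r : ℝ) ^ 2) + 1 / (72 * r ^ 2) := by
        field_simp; ring
      linarith [hmax, hξ2, hzup, h2]
    have hξneg : ξ < 0 := lt_of_le_of_lt hξup (by
      rw [div_lt_iff₀ (by positivity)]; nlinarith)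
    have habsξ : |ξ| = -ξ := abs_of_neg hξneg
    have hA : 1 / (36 * (r : ℝ)) ≤ |ξ| := by
      rw [habsξ]
      have : 1 / (36 * (r : ℝ)) = 2 * r / (72 * r ^ 2) := by field_simp; ring
      rw [this]; linarith [hξup, show -(2 * (r : ℝ)) / (72 * r ^ 2) = -(2 * r / (72 * r ^ 2)) by ring]
    have hB : |ξ| ≤ 5 / (72 * (r : ℝ)) := by
      rw [habsξ]
      have : 5 / (72 * (r : ℝ)) = 5 * r / (72 * r ^ 2) := by field_simp
      rw [this]; linarith [hξlo, show -(5 * (r : ℝ)) / (72 * r ^ 2) = -(5 * r / (72 * r ^ 2)) by ring]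
    have hξ1' : -1 < ξ := by
      have : 5 / (72 * (r : ℝ)) < 1 := by rw [div_lt_one (by positivity)]; nlinarith
      have := (neg_abs_le ξ); linarith [hB]
    have hsin := abs_sin_two_mul_arccos_ge r hr hA hB
    have hder := abs_deriv_chebyshevT_sq_ge (4 * (3 * r)) hξ1' (by linarith)
    have hk0 : (0 : ℝ) ≤ ((4 * (3 * r) : ℕ) : ℝ) := Nat.cast_nonneg _
    calc ((4 * (3 * r) : ℕ) : ℝ) / 2 = ((4 * (3 * r) : ℕ) : ℝ) * (1 / 2) := by ring
      _ ≤ ((4 * (3 * r) : ℕ) : ℝ) * |Real.sin (2 * ((4 * (3 * r) : ℕ) : ℝ) * Real.arccos ξ)| :=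
          mul_le_mul_of_nonneg_left hsin hk0
      _ ≤ _ := hder
  have hmv := abs_chebyshevT_sq_sub_ge (4 * (3 * r)) hwin
  rw [abs_sub_comm, hstep] at hmv
  -- `(k/2)·(1/(72r²)) = 1/(12r)`; square it
  have hk : ((4 * (3 * r) : ℕ) : ℝ) / 2 * (1 / (72 * (r : ℝ) ^ 2)) = 1 / (12 * r) := by
    push_cast; field_simp; ring
  rw [hk] at hmv
  have hsq := pow_le_pow_left₀ (by positivity) hmv 2
  rw [sq_abs] at hsq
  have h144 : (1 / (12 * (r : ℝ))) ^ 2 = 1 / (144 * r ^ 2) := by field_simp; ring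
  rw [h144] at hsq
  exact hsq

/-- **Influence LOWER bound on the calibrating instance**: for `k = 12r`, `N = k²`, EVERY variable has
`Infᵢ[p_k] ≥ (47/648)/k²` (oscillation window of probability `≥ 47/648`, on which `(Δᵢ p_k)² ≥ 1/k²`).
With `…ChebyshevInfluence.lean`: `(47/648)/k² ≤ Infᵢ[p_k] ≤ 29/k²` for all `i`. [folklore] -/
theorem influence_chebyshevT_sq_ge (r : ℕ) (hr : 1 ≤ r) (i : Fin (144 * r ^ 2)) :
    (47 / 648 : ℝ) / ((4 * (3 * r) : ℕ) : ℝ) ^ 2 ≤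
      influence i ((Polynomial.aeval (∑ i : Fin (144 * r ^ 2), (MvPolynomial.C (1 / ((144 * r ^ 2 : ℕ) : ℝ)) -
          MvPolynomial.C (2 / ((144 * r ^ 2 : ℕ) : ℝ)) * MvPolynomial.X i))
          (Polynomial.Chebyshev.T ℝ ((4 * (3 * r) : ℕ) : ℤ))) ^ 2) := by
  classical
  have hr0 : (0 : ℝ) < r := by exact_mod_cast (show 0 < r by omega)
  unfold influence
  -- window probability `≥ 47/648`
  have hP := sum_choose_div_le_boolAvg (N := 144 * r ^ 2)
    (fun x : Fin (144 * r ^ 2) → Bool => (Finset.univ.filter (fun j => x j = true)).card ∈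
      Finset.Icc (72 * r ^ 2 + 2 * r + 1) (72 * r ^ 2 + 5 * r - 1))
    (Finset.Icc (72 * r ^ 2 + (2 * r + 1)) (72 * r ^ 2 + (5 * r - 1)))
    (fun x hx => by rw [Finset.mem_Icc] at hx ⊢; omega)
  have hS := window_sum_lower r (2 * r + 1) (5 * r - 1) hr (c := 25 / 72) (by norm_num)
    (by
      have : ((5 * r - 1 : ℕ) : ℝ) ≤ 5 * r := by
        have h : 5 * r - 1 ≤ 5 * r := Nat.sub_le _ _
        exact_mod_cast h
      have h0 : (0 : ℝ) ≤ ((5 * r - 1 : ℕ) : ℝ) := Nat.cast_nonneg _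
      push_cast; nlinarith)
  have hcount : (2 * (r : ℝ)) ≤ ((5 * r - 1 + 1 - (2 * r + 1) : ℕ) : ℝ) := by
    have : 2 * r ≤ 5 * r - 1 + 1 - (2 * r + 1) := by omega
    exact_mod_cast this
  have h47 : (47 / 648 : ℝ) ≤ ((5 * r - 1 + 1 - (2 * r + 1) : ℕ) : ℝ) * ((1 - 25 / 72) / (18 * r)) := by
    have hpos : (0 : ℝ) ≤ (1 - 25 / 72) / (18 * r) := by positivity
    calc (47 / 648 : ℝ) = 2 * r * ((1 - 25 / 72) / (18 * r)) := by field_simp; ring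
      _ ≤ _ := mul_le_mul_of_nonneg_right hcount hpos
  have hW := h47.trans (hS.trans hP)
  -- pointwise: `(Δᵢ p)² ≥ (1/(144 r²))·[x ∈ W]`
  have hpt := AaronsonAmbainisL1.boolAvg_mono (N := 144 * r ^ 2)
    (f := fun x : Fin (144 * r ^ 2) → Bool => (1 / (144 * (r : ℝ) ^ 2)) *
      (if (Finset.univ.filter (fun j => x j = true)).card ∈
          Finset.Icc (72 * r ^ 2 + 2 * r + 1) (72 * r ^ 2 + 5 * r - 1) then (1 : ℝ) else 0))
    (g := fun x => (evalBool ((Polynomial.aeval (∑ i : Fin (144 * r ^ 2), (MvPolynomial.C (1 / ((144 * r ^ 2 : ℕ) : ℝ)) -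
          MvPolynomial.C (2 / ((144 * r ^ 2 : ℕ) : ℝ)) * MvPolynomial.X i))
          (Polynomial.Chebyshev.T ℝ ((4 * (3 * r) : ℕ) : ℤ))) ^ 2) x -
        evalBool ((Polynomial.aeval (∑ i : Fin (144 * r ^ 2), (MvPolynomial.C (1 / ((144 * r ^ 2 : ℕ) : ℝ)) -
          MvPolynomial.C (2 / ((144 * r ^ 2 : ℕ) : ℝ)) * MvPolynomial.X i))
          (Polynomial.Chebyshev.T ℝ ((4 * (3 * r) : ℕ) : ℤ))) ^ 2) (flipBit i x)) ^ 2)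
    (fun x => by
      split_ifs with hx
      · rw [mul_one]; exact sq_sub_flipBit_chebyshevT_sq_ge r hr i x hx
      · rw [mul_zero]; exact sq_nonneg _)
  rw [avg_const_mul] at hpt
  have hk2 : ((4 * (3 * r) : ℕ) : ℝ) ^ 2 = 144 * (r : ℝ) ^ 2 := by push_cast; ring
  rw [hk2]
  calc (47 / 648 : ℝ) / (144 * (r : ℝ) ^ 2) = (1 / (144 * (r : ℝ) ^ 2)) * (47 / 648) := by ring
    _ ≤ (1 / (144 * (r : ℝ) ^ 2)) * boolAvg (fun x : Fin (144 * r ^ 2) → Bool =>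
        if (Finset.univ.filter (fun j => x j = true)).card ∈
            Finset.Icc (72 * r ^ 2 + 2 * r + 1) (72 * r ^ 2 + 5 * r - 1) then (1 : ℝ) else 0) :=
        mul_le_mul_of_nonneg_left hW (by positivity)
    _ ≤ _ := hpt

/-- **The Chebyshev family sits AT the `(2, 2)` corner — it does not cross it.** On the calibrating instance
(`k = 12r`, `N = k²`) every influence satisfies `Infᵢ[p_k] ≥ (94/81)·Var[p_k]²/k²` (from `Infᵢ ≥ (47/648)/k²`
and `Var ≤ 1/4`): the candidate law `maxInf ≥ C·Var²/T²` holds on this family with an absolute constant, so the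
amplitude-amplification calibrator forces `b ≥ 2` but is consistent with `(a, b) = (2, 2)`. [folklore] -/
theorem chebyshev_family_twoTwo_law (r : ℕ) (hr : 1 ≤ r) (i : Fin (144 * r ^ 2)) :
    (94 / 81 : ℝ) * boolVariance ((Polynomial.aeval (∑ i : Fin (144 * r ^ 2),
        (MvPolynomial.C (1 / ((144 * r ^ 2 : ℕ) : ℝ)) -
          MvPolynomial.C (2 / ((144 * r ^ 2 : ℕ) : ℝ)) * MvPolynomial.X i))
        (Polynomial.Chebyshev.T ℝ ((4 * (3 * r) : ℕ) : ℤ))) ^ 2) ^ 2 / ((4 * (3 * r) : ℕ) : ℝ) ^ 2 ≤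
      influence i ((Polynomial.aeval (∑ i : Fin (144 * r ^ 2), (MvPolynomial.C (1 / ((144 * r ^ 2 : ℕ) : ℝ)) -
          MvPolynomial.C (2 / ((144 * r ^ 2 : ℕ) : ℝ)) * MvPolynomial.X i))
          (Polynomial.Chebyshev.T ℝ ((4 * (3 * r) : ℕ) : ℤ))) ^ 2) := by
  have hinf := influence_chebyshevT_sq_ge r hr i
  have hpb := pseudoBounded_chebyshevT_sq (N := 144 * r ^ 2) (4 * (3 * r)) (by omega) (by nlinarith)
  have hV := boolVariance_le_quarter hpb
  have hV0 := boolVariance_nonneg ((Polynomial.aeval (∑ i : Fin (144 * r ^ 2),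
        (MvPolynomial.C (1 / ((144 * r ^ 2 : ℕ) : ℝ)) -
          MvPolynomial.C (2 / ((144 * r ^ 2 : ℕ) : ℝ)) * MvPolynomial.X i))
        (Polynomial.Chebyshev.T ℝ ((4 * (3 * r) : ℕ) : ℤ))) ^ 2)
  have hk0 : (0 : ℝ) < ((4 * (3 * r) : ℕ) : ℝ) ^ 2 := by
    have : (0 : ℝ) < ((4 * (3 * r) : ℕ) : ℝ) := by exact_mod_cast (show 0 < 4 * (3 * r) by omega)
    positivity
  refine le_trans ?_ hinf
  rw [div_le_div_iff_of_pos_right hk0]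
  nlinarith [hV, hV0, mul_nonneg hV0 hV0]

end Summit.QuantumAdvantage.QuantumAdvantage.Theorems.SosSandwich

end
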